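import Summits.RiemannHypothesis.RiemannHypothesis.Theorems.SemilocalNegCertFiftyNineKinked2061
import HarnessLib

/-!
# Semi-local threshold of the `{∞,2,…,59}` form, negative side: `a*({2,…,59}) ≤ 1055 / 512 = 2.060546875` — the wall `q = 61` from a KINKED (piecewise-cubic) witness with slope breaks at the prime-atom images (part 12/23: the kernel facts piece 158 … piece 171 of 298 (imports part 1 only))

Cell `rh-explicit` (HOME `run/shared/lean/pub/rh-explicit/`), seat cc-s2-9 gen3 (HUMAN RULING D-0074 (D5) WEIL data engine; LADDER-RH column WEIL, rung DATA → W-P(P2);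
pipeline = cc-s2-4 gen8/gen11's piecewise-witness layer `SemilocalPiecewise{Witness,Increment,IncrementSum,Cert}.lean` + their float finder, every number
re-derived by an independent second engine E2 before filing; gen0/gen2 rows: `SemilocalNegCert{ThirteenKinked1423,…,FiftyThreeKinked2044}*`, capstone `SemilocalKinkedWallOffsets`).
HONEST FRAMING: RH-FREE theorems about the tree's `weilSemilocalThreshold S` of a TRUNCATED Weil form (finitely many places); nothing here bears on the
truth of RH; the lower clause `(log q)/2 ≤ a*(S_q)` at all primes IS RH and is untouched; the SIGN of `δ*(61)` is not claimed.

KINKED row for the wall `q = 61` (`S = {2,…,59}`): at `b = 1055 / 512 = 2.060546875 ≈ a*(S_61) + 0.0051` (DATA, two engines, cc-s2-6/cc-s2-3: `a*(S_61) = 2.0554656`)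
the polynomial × indicator class is far from negative (tree row `267/128`, `SemilocalNegCertUptoFiftyNine`, `δ*(61) ≤ 0.0305`), whereas an odd piecewise cubic with slope breaks at the images
`|b − log n|` (rounded to `/1024`) of the atoms `n ∈ {3,5,7,11,13,17,19,23,29,31,37,41,43,47,53,59}` (the odd-prime atoms; all atom images resp. all primes resp. primes + 4 + 9 scanned, kit j257393) is negative by `2.827e-03·‖G‖²`.
Instance: `S = {2, 3, 5, 7, 11, 13, 17, 19, 23, 29, 31, 37, 41, 43, 47, 53, 59}`, `N = 63` (atom table `atomsUptoFiftyNineN63` / `atomsEnclose_UptoFiftyNineN63` of THIS file: the tree's `atomsUptoFiftyNine` (`N = 64`, `SemilocalNegCertUptoFiftyNine.lean`) minus the atom `64`, whose image lies above `2b`), 17 pieces of degree ≤ 3, 298 `t`-pieces;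
TWO ENGINES on the witness before the kernel: cc-s2-4's float finder `λ_min = -2.8274e-03` and the seat's exact-in-`x` decimal engine E2 `R = -2.8378e-03` (no polar credit);
the exact kernel margin is the certificate's own rational arithmetic (farm report).  ⇒ **`a*({2,…,59}) ≤ 1055 / 512`, `δ*(61) < 0.00511`** (was `0.0305`).
No data is trusted: every bound is a `decide +kernel` fact.  Folklore throughout.
-/

set_option autoImplicit false
set_option linter.dupNamespace false  -- the mandated namespace repeats `RiemannHypothesis`
set_option Elab.async false  -- serialise the kernel facts: in parallel they exhaust the node's per-process heap (cc-s2-4 gen11, CC4-LEAN §16.10)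

noncomputable section

open Complex Filter Set MeasureTheory Topology
open scoped Real

namespace Summit.RiemannHypothesis.RiemannHypothesis.Theorems.SemilocalPolyWitness

open MeasureTheory Set Finset Real
open Literature.NumberTheory.LFunctions
open Summit.RiemannHypothesis.RiemannHypothesis.Theorems.MotivicDoor
open Summit.RiemannHypothesis.RiemannHypothesis.Theorems.MotivicDoor.SemilocalThreshold
open Summit.RiemannHypothesis.RiemannHypothesis.Theorems.MotivicDoor.SemilocalMarkov
open LQ

set_option maxHeartbeats 0 in
/-- kernel fact: piece `158` of `certFiftyNineKinked2061`. -/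
theorem check_FiftyNineKinked2061_piece158 : certFiftyNineKinked2061.checkPiecePW 158 = true := by
  decide +kernel

set_option maxHeartbeats 0 in
/-- kernel fact: piece `159` of `certFiftyNineKinked2061`. -/
theorem check_FiftyNineKinked2061_piece159 : certFiftyNineKinked2061.checkPiecePW 159 = true := by
  decide +kernel

set_option maxHeartbeats 0 in
/-- kernel fact: piece `160` of `certFiftyNineKinked2061`. -/
theorem check_FiftyNineKinked2061_piece160 : certFiftyNineKinked2061.checkPiecePW 160 = true := by
  decide +kernel

set_option maxHeartbeats 0 in
/-- kernel fact: piece `161` of `certFiftyNineKinked2061`. -/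
theorem check_FiftyNineKinked2061_piece161 : certFiftyNineKinked2061.checkPiecePW 161 = true := by
  decide +kernel

set_option maxHeartbeats 0 in
/-- kernel fact: piece `162` of `certFiftyNineKinked2061`. -/
theorem check_FiftyNineKinked2061_piece162 : certFiftyNineKinked2061.checkPiecePW 162 = true := by
  decide +kernel

set_option maxHeartbeats 0 in
/-- kernel fact: piece `163` of `certFiftyNineKinked2061`. -/
theorem check_FiftyNineKinked2061_piece163 : certFiftyNineKinked2061.checkPiecePW 163 = true := by
  decide +kernel

set_option maxHeartbeats 0 in
/-- kernel fact: piece `164` of `certFiftyNineKinked2061`. -/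
theorem check_FiftyNineKinked2061_piece164 : certFiftyNineKinked2061.checkPiecePW 164 = true := by
  decide +kernel

set_option maxHeartbeats 0 in
/-- kernel fact: piece `165` of `certFiftyNineKinked2061`. -/
theorem check_FiftyNineKinked2061_piece165 : certFiftyNineKinked2061.checkPiecePW 165 = true := by
  decide +kernel

set_option maxHeartbeats 0 in
/-- kernel fact: piece `166` of `certFiftyNineKinked2061`. -/
theorem check_FiftyNineKinked2061_piece166 : certFiftyNineKinked2061.checkPiecePW 166 = true := by
  decide +kernel

set_option maxHeartbeats 0 in
/-- kernel fact: piece `167` of `certFiftyNineKinked2061`. -/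
theorem check_FiftyNineKinked2061_piece167 : certFiftyNineKinked2061.checkPiecePW 167 = true := by
  decide +kernel

set_option maxHeartbeats 0 in
/-- kernel fact: piece `168` of `certFiftyNineKinked2061`. -/
theorem check_FiftyNineKinked2061_piece168 : certFiftyNineKinked2061.checkPiecePW 168 = true := by
  decide +kernel

set_option maxHeartbeats 0 in
/-- kernel fact: piece `169` of `certFiftyNineKinked2061`. -/
theorem check_FiftyNineKinked2061_piece169 : certFiftyNineKinked2061.checkPiecePW 169 = true := by
  decide +kernel

set_option maxHeartbeats 0 in
/-- kernel fact: piece `170` of `certFiftyNineKinked2061`. -/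
theorem check_FiftyNineKinked2061_piece170 : certFiftyNineKinked2061.checkPiecePW 170 = true := by
  decide +kernel

set_option maxHeartbeats 0 in
/-- kernel fact: piece `171` of `certFiftyNineKinked2061`. -/
theorem check_FiftyNineKinked2061_piece171 : certFiftyNineKinked2061.checkPiecePW 171 = true := by
  decide +kernel

end Summit.RiemannHypothesis.RiemannHypothesis.Theorems.SemilocalPolyWitness

end
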